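import Summits.BirchSwinnertonDyer.Rank1Residual.Partition.GreenbergVatsalIsogenyPeriodStep
import HarnessLib

/-!
# Greenberg–Vatsal 2000, Cor. (3.8), period clause — PROVED: inside a `ℚ`-isogeny class satisfying
# the parity hypothesis at an odd good-ordinary-or-multiplicative `p`, the Néron real periods agree up
# to `p`-adic units (cell `b2b-bsdres`, unit `b2b-bsdres-lit-cgls`, GEN 16)

HONEST FRAMING (run/shared/lean/b2b/bsd-rank1-residual/, verbatim in every file): the goal of the
cell is to DELETE the COMBINATION-SHAPED residual classes of the Birch–Swinnerton-Dyer formula for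
ALL analytic-rank `≤ 1` elliptic curves over `ℚ` — "full BSD formula for every rank `≤ 1` curve in
class `C`" assembled STRICTLY from published theorems — so that the rank-`≤ 1` remainder becomes
exactly the CONSTRUCTION-SHAPED classes, which are TYPED (missing-input `Prop`s), NOT attempted.
This is not "finishing BSD". NO CLAIM BEYOND STATED CLASSES; nothing here changes a label.
Theorems only; no definition, no named fact.

WHAT. The registered named fact A180
`Literature.NumberTheory.EllipticCurves.GreenbergVatsal2000.cor38_realPeriodRat_eq_unit_mul_of_isIsogenous_of_gvPar`
(Greenberg–Vatsal, Invent. Math. 142 (2000), §3 Cor. (3.8), period clause, relative form: for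
`ℚ`-isogenous globally minimal `E`, `E'`, `p` odd of good ordinary or multiplicative reduction,
both satisfying the parity hypothesis `GVPar`, `Ω(E') = u · Ω(E)` with `u ∈ ℚ`, `|u|_p = 1`) — the
binder `hP` of the cell's closing forms `Partition/CornersMult*`, `Partition/CornersFiveLe*`,
`X2/ClassClosureOfDatum` — is PROVED here in closed form
(`cor38_realPeriodRat_eq_unit_mul_of_isIsogenous_of_gvPar_holds`, last section), so that every
`hP` can be fed a term. The printed proof (p. 40 with p. 38) goes through Stevens' étale isogenies
from the minimal curve of the class [Ste89]; the tree has no such theorem and vendoring it would be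
a new named fact, so the proof below is a different, elementary one, assembled from kernel
theorems of the tree only (unit `eisenstein-p2`'s consumer form for ONE quotient by an
unramified-odd line, `X2.IsogenyPeriodRatio.exists_quot_realPeriodRat_eq_unit_mul`, gen 28; Milne's
archimedean factor and the Néron-lattice bookkeeping of
`SkinnerUrban2014.exists_int_mul_realPeriodRat_eq_of_isogeny`; Silverman III.4.11 / III.6.1
factorisation and duals; the Greenberg–Vatsal line-type theory of `Rank1Residual/GVParity*` and
the Tate-free inertia line of `Partition/EisensteinKernelInertiaLineMult`).

PROOF (new; recorded in HOME/b2b-bsdres-lit-cgls/CGLS-GV-TYPING.md §23). For a `ℚ`-isogeny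
`ψ : E₁ → E₂` of globally minimal curves, strong induction on `#ker ψ`:
* §3 `p ∤ #ker ψ`: `q·Ω(E₁) = a·Ω(E₂)` with `q ∣ d`, `ab = d` (lattice step) ⇒ `u = q/a` is a unit.
* `E₁[p] ⊆ ker ψ`: `ψ = λ ∘ [p]` (*AEC* III.4.11 for `[p]`), `#ker λ = #ker ψ / p²`.
* otherwise `Φ₀ = ker ψ ∩ E₁[p]` is a rational `p`-line, of Greenberg–Vatsal type because `E₁`
  satisfies `GVPar` and the type does not depend on the line (`gvType_of_isRationalLine_of_ordinaryLine`,
  with Serre's line (hL) at good ordinary `p` / the Tate-free inertia line at `p ‖ N`); `ψ = λ ∘ g`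
  for the quotient `g : E₁ → E₁/Φ₀` onto a minimal model, `#ker λ = #ker ψ / p`, and §4 ONE STEP:
  along an isogeny whose kernel is a GV-type rational `p`-line the period changes by a `p`-unit —
  for an UNRAMIFIED-ODD kernel this is `eisenstein-p2`'s theorem (transported to an arbitrary
  isogeny with that kernel by a degree-`1` factorisation), for a RAMIFIED-EVEN kernel `Φ₀` one
  passes to the DUAL `ĝ : E₁/Φ₀ → E₁`, whose kernel `g(E₁[p]) ≅ E₁[p]/Φ₀` is unramified (inertia
  acts on `E₁[p]` through `(χ *; 0 1)` with `χ`-line `Φ₀`) and odd (complex conjugation has both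
  signs on `E₁[p]`), §1.
Isogeny invariance of the reduction type / ordinarity / `GVPar` / the newform carries the
hypotheses along the induction. (Remark, not used: along a `p`-isogeny whose kernel is a line of
the OTHER type the ratio is `p^{±1}` — `X₀(11)` at `5`: `Ω(11a3) = 5·Ω(11a1)`, `Ω(11a2) = Ω(11a1)/5`;
a ramified-even kernel has multiplier of valuation `1` AND `p` real points, ratio `1`.)

References: [GreenbergVatsal2000] §3 Cor. (3.8) p. 40, Lemma (3.6) p. 38, Remark (3.4);
[MilneADT2006] I §7; [SilvermanAEC2009] III.4.11, III.6.1–6.2, VI.4.1(b); [SerreInventiones1972]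
§1.11–1.12; [DokchitserLocalInvariants2015] Thm. 2 (printed counterpart of the one-step lemma);
HOME/b2b-bsdres-eisenstein-p2/X2-GAP.md §33 (consumer form; the doubt raised in §33.3 about the
registered relative wording is settled here in the affirmative).
-/

set_option autoImplicit false

noncomputable section

open scoped Classical NumberField MatrixGroups ModularForm

open WeierstrassCurve CongruenceSubgroup Field IsDedekindDomain NumberField
  Literature.NumberTheory.EllipticCurves Literature.NumberTheory.EllipticCurves.Rank1Residual
  Literature.NumberTheory.EllipticCurves.ModularForms Literature.NumberTheory.GaloisRepresentations
  Literature.NumberTheory.EllipticCurves.GreenbergVatsal2000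

namespace Summit.BirchSwinnertonDyer.Rank1Residual.GVPeriod

variable {W W' : WeierstrassCurve ℚ} {p : ℕ} [hp : Fact p.Prime]

/-! ## §5. ONE STEP: an isogeny whose kernel is a rational `p`-line of Greenberg–Vatsal type -/

section OneStep

variable [W.IsElliptic] [W'.IsElliptic] [W.IsGloballyMinimal] [W'.IsGloballyMinimal]
  {N : ℕ} [NeZero N] {f : CuspForm (Gamma0 N) 2}

/-- **ONE STEP, unramified-odd kernel, arbitrary isogeny.** For globally minimal `E`, `E'`, `p` odd
of good ordinary or multiplicative reduction for `E`, and a `ℚ`-isogeny `ψ : E → E'` whose kernel is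
a rational `p`-line `Φ₀` UNRAMIFIED at `p` and ODD: `Ω(E') = u·Ω(E)`, `|u|_p = 1`. Unit
`eisenstein-p2`'s `X2.IsogenyPeriodRatio.exists_quot_realPeriodRat_eq_unit_mul` gives this for ITS
quotient `g : E → E₂`; `ψ = λ ∘ g` with `deg λ = 1` (§4), and `λ` changes the period by a unit (§3).
[cite: GreenbergVatsal2000, §3 Cor. (3.8) p. 40] [cite: DokchitserLocalInvariants2015, Thm. 2] -/
theorem exists_unit_of_ker_unramified_odd (hp2 : p ≠ 2)
    (hred : (W.HasGoodReductionAtPrime p ∧ ¬ (p : ℤ) ∣ W.frobeniusTrace p) ∨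
      W.HasMultiplicativeReductionAtPrime p)
    (hf : IsNewformOf W f) {Φ₀ : AddSubgroup (geomTorsion W (p : ℤ))} (hΦ : IsRationalLine W p Φ₀)
    (hunr : LineUnramifiedAt W p Φ₀) (hodd : LineOdd W p Φ₀) (ψ : Isogeny W W')
    (hker : ψ.toAddMonoidHom.ker = Φ₀.map (geomTorsion W (p : ℤ)).subtype) :
    ∃ u : ℚ, ‖(u : ℚ_[p])‖ = 1 ∧ W'.realPeriodRat = (u : ℝ) * W.realPeriodRat := by
  have hpP : p.Prime := hp.out
  obtain ⟨W₂, hW₂, hW₂', g, hgker, -, u, hu, hΩ⟩ :=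
    X2.IsogenyPeriodRatio.exists_quot_realPeriodRat_eq_unit_mul hp2 hred hΦ hunr hodd
  obtain ⟨lam, hdeg, -⟩ := exists_degree_one_of_ker_eq g ψ (hgker.trans hker.symm)
  have hiso₂ : IsIsogenous W W₂ := ⟨g⟩
  have hf₂ : IsNewformOf W₂ f := hf.of_isIsogenous hiso₂.symm_of_charZero
  obtain ⟨u', hu', hΩ'⟩ := exists_unit_of_not_dvd_degree hf₂ lam
    (by rw [hdeg]; exact hpP.one_lt.ne' ∘ Nat.dvd_one.mp)
  refine ⟨u' * u, ?_, ?_⟩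
  · rw [Rat.cast_mul, norm_mul, hu', hu, one_mul]
  · rw [hΩ', hΩ, Rat.cast_mul, mul_assoc]

/-- **ONE STEP, ramified-even kernel: the DUAL trick.** Same setting, kernel `Φ₀` RAMIFIED at `p`
and EVEN. The dual `ψ̂ : E' → E` (`ψ̂ ∘ ψ = [p]`, *AEC* III.6.1) has kernel `ψ(E[p]) ≅ E[p]/Φ₀`
(§2), a rational `p`-line of `E'` which is UNRAMIFIED and ODD (§1, with (hL) and (hc) for `E`);
`E'` is again good ordinary / multiplicative at `p`; so `Ω(E) = v·Ω(E')` with `|v|_p = 1` by the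
unramified-odd step applied to `ψ̂`, and `u = v⁻¹`.
[cite: GreenbergVatsal2000, §3 Cor. (3.8) p. 40 and §2 p. 28] [cite: SilvermanAEC2009, Thm. III.6.1] -/
theorem exists_unit_of_ker_ramified_even (hp2 : p ≠ 2)
    (hred : (W.HasGoodReductionAtPrime p ∧ ¬ (p : ℤ) ∣ W.frobeniusTrace p) ∨
      W.HasMultiplicativeReductionAtPrime p)
    (hf : IsNewformOf W f) {Φ₀ : AddSubgroup (geomTorsion W (p : ℤ))} (hΦ : IsRationalLine W p Φ₀)
    (hram : ¬ LineUnramifiedAt W p Φ₀) (heven : LineEven W p Φ₀) (ψ : Isogeny W W')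
    (hker : ψ.toAddMonoidHom.ker = Φ₀.map (geomTorsion W (p : ℤ)).subtype) :
    ∃ u : ℚ, ‖(u : ℚ_[p])‖ = 1 ∧ W'.realPeriodRat = (u : ℝ) * W.realPeriodRat := by
  have hpP : p.Prime := hp.out
  -- the dual isogeny
  have hcard : Nat.card ψ.toAddMonoidHom.ker = p := by
    rw [hker]; exact X2.IsogenyQuotientLine.natCard_map_subtype hΦ
  obtain ⟨lam, -⟩ := exists_degree_one_of_ker_eq ψ ψ rfl
  haveI : FiniteDimensional ψ.pullbackField W.geomFunctionField :=
    Isogeny.finiteDimensional_pullbackField_holds W W' ψ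
  haveI : CharZero W.geomFunctionField :=
    charZero_of_injective_ringHom (algebraMap ℚ W.geomFunctionField).injective
  haveI : CharZero ψ.pullbackField := (algebraMap ψ.pullbackField W.geomFunctionField).charZero
  haveI : Algebra.IsSeparable ψ.pullbackField W.geomFunctionField :=
    Algebra.IsAlgebraic.isSeparable_of_perfectField
  obtain ⟨fd, hfd, -⟩ :=
    ψ.exists_dual_of_deg_le_card_ker ((ψ.deg_le_card_ker_iff_isSeparable).mpr inferInstance)
  rw [hcard] at hfd
  have hfd' : ∀ P : geomPoints W, fd (ψ P) = (p : ℤ) • P := fun P ↦ by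
    rw [hfd P, natCast_zsmul]
  -- the kernel of the dual is the image line, unramified and odd
  obtain ⟨g, hgval, hg⟩ := X2.IsogenyLineType.exists_restrict_torsion (p := p) ψ
  have hK : g.ker = Φ₀ := ker_restrict_eq ψ hgval hker
  obtain ⟨hline, hunr', hodd'⟩ := unramified_odd_range_of_ramified_even_ker g hg hp2
    (Rank1Residual.natCard_geomTorsion W p) (exists_inertiaLine_of_goodOrd_or_mult W p hp2 hred)
    (exists_fixed_and_antifixed_of_isComplexConjugation W hp2) (hK ▸ hΦ.1) (hK ▸ hram)
    (hK ▸ heven)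
  have hkerfd : fd.toAddMonoidHom.ker = g.range.map (geomTorsion W' (p : ℤ)).subtype :=
    ker_dual_eq_map_range ψ fd hfd' hgval
  -- the unramified-odd step for the dual, from `E'`
  have hiso : IsIsogenous W W' := ⟨ψ⟩
  have hred' := goodOrd_or_mult_of_isIsogenous (p := p) hiso hred
  have hf' : IsNewformOf W' f := hf.of_isIsogenous hiso.symm_of_charZero
  obtain ⟨v, hv, hΩ⟩ := exists_unit_of_ker_unramified_odd hp2 hred' hf' hline hunr' hodd' fd hkerfd
  have hv0 : (v : ℚ_[p]) ≠ 0 := fun h ↦ by rw [h, norm_zero] at hv; exact zero_ne_one hv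
  have hv0' : v ≠ 0 := fun h ↦ hv0 (by rw [h, Rat.cast_zero])
  refine ⟨v⁻¹, ?_, ?_⟩
  · rw [Rat.cast_inv, norm_inv, hv, inv_one]
  · have hvR : (v : ℝ) ≠ 0 := by exact_mod_cast hv0'
    rw [hΩ, Rat.cast_inv, ← mul_assoc, inv_mul_cancel₀ hvR, one_mul]

/-- **ONE STEP** (both cases): along a `ℚ`-isogeny of globally minimal curves whose kernel is a
rational `p`-line of Greenberg–Vatsal type — (ramified ∧ even) ∨ (unramified ∧ odd) — at an odd
prime of good ordinary or multiplicative reduction, the Néron real period changes by a `p`-adic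
unit. [cite: GreenbergVatsal2000, §3 Cor. (3.8) p. 40] -/
theorem exists_unit_of_ker_gvType (hp2 : p ≠ 2)
    (hred : (W.HasGoodReductionAtPrime p ∧ ¬ (p : ℤ) ∣ W.frobeniusTrace p) ∨
      W.HasMultiplicativeReductionAtPrime p)
    (hf : IsNewformOf W f) {Φ₀ : AddSubgroup (geomTorsion W (p : ℤ))} (hΦ : IsRationalLine W p Φ₀)
    (htype : (¬ LineUnramifiedAt W p Φ₀ ∧ LineEven W p Φ₀) ∨
      (LineUnramifiedAt W p Φ₀ ∧ LineOdd W p Φ₀))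
    (ψ : Isogeny W W') (hker : ψ.toAddMonoidHom.ker = Φ₀.map (geomTorsion W (p : ℤ)).subtype) :
    ∃ u : ℚ, ‖(u : ℚ_[p])‖ = 1 ∧ W'.realPeriodRat = (u : ℝ) * W.realPeriodRat := by
  rcases htype with ⟨hram, heven⟩ | ⟨hunr, hodd⟩
  · exact exists_unit_of_ker_ramified_even hp2 hred hf hΦ hram heven ψ hker
  · exact exists_unit_of_ker_unramified_odd hp2 hred hf hΦ hunr hodd ψ hker

end OneStep

/-! ## §6. The induction on `#ker ψ` and Cor. (3.8) -/

section Induction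

variable {N : ℕ} [NeZero N] (f : CuspForm (Gamma0 N) 2)

/-- **The `p`-torsion part of the kernel of an isogeny not killing `E[p]`, when `p ∣ #ker ψ`, is a
rational `p`-line.** `Φ₀ = ker ψ ∩ E[p]` is `Γ_ℚ`-stable, of order dividing `p²`, not `p²`
(`E[p] ⊄ ker ψ`) and not `1` (Cauchy: `ker ψ` has an element of order `p`). [folklore] -/
theorem isRationalLine_ker_inf_torsion [W.IsElliptic] (ψ : Isogeny W W')
    (hdvd : p ∣ ψ.degree) (hne : ∃ P : geomPoints W, P ∈ geomTorsion W (p : ℤ) ∧ ψ P ≠ 0) :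
    IsRationalLine W p (ψ.toAddMonoidHom.ker.comap (geomTorsion W (p : ℤ)).subtype) := by
  have hpP : p.Prime := hp.out
  set Φ₀ := ψ.toAddMonoidHom.ker.comap (geomTorsion W (p : ℤ)).subtype with hΦ₀
  have hmem : ∀ P : geomTorsion W (p : ℤ), P ∈ Φ₀ ↔ ψ (P : geomPoints W) = 0 := fun P ↦ by
    rw [hΦ₀, AddSubgroup.mem_comap, AddMonoidHom.mem_ker]; rfl
  haveI : Finite (geomTorsion W (p : ℤ)) := Nat.finite_of_card_ne_zero (by
    rw [Rank1Residual.natCard_geomTorsion W p]; exact pow_ne_zero 2 hpP.ne_zero)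
  refine ⟨?_, fun σ P hP ↦ ?_⟩
  · -- the order divides `p²`
    have hdvd2 : Nat.card Φ₀ ∣ p ^ 2 := by
      rw [← Rank1Residual.natCard_geomTorsion W p]
      exact AddSubgroup.card_addSubgroup_dvd_card Φ₀
    obtain ⟨i, hi, hcard⟩ := (Nat.dvd_prime_pow hpP).mp hdvd2
    -- not `p²`
    have hi2 : i ≠ 2 := by
      rintro rfl
      have htop : Φ₀ = ⊤ := AddSubgroup.eq_top_of_card_eq Φ₀ (by
        rw [hcard, Rank1Residual.natCard_geomTorsion W p])
      obtain ⟨P, hP, hP0⟩ := hne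
      exact hP0 ((hmem ⟨P, hP⟩).mp (htop ▸ AddSubgroup.mem_top _))
    -- not `1`: an element of order `p` in `ker ψ`
    have hi0 : i ≠ 0 := by
      rintro rfl
      rw [pow_zero] at hcard
      haveI : Fact p.Prime := hp
      have hdvd' : p ∣ Nat.card ψ.toAddMonoidHom.ker := hdvd
      obtain ⟨Q, hQ⟩ := exists_prime_addOrderOf_dvd_card' (G := ψ.toAddMonoidHom.ker) p hdvd'
      have hQp : (p : ℤ) • (Q : geomPoints W) = 0 := by
        rw [natCast_zsmul, ← AddSubgroupClass.coe_nsmul, ← hQ, addOrderOf_nsmul_eq_zero,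
          ZeroMemClass.coe_zero]
      have hQmem : (⟨(Q : geomPoints W), (mem_geomTorsion_iff W (p : ℤ) _).mpr hQp⟩ :
          geomTorsion W (p : ℤ)) ∈ Φ₀ := by
        rw [hmem]
        have := Q.2
        rwa [AddMonoidHom.mem_ker] at this
      have hone : ∀ x ∈ Φ₀, x = (⟨0, zero_mem _⟩ : Φ₀).1 := fun x hx ↦ by
        have hsub : Subsingleton Φ₀ := (Nat.card_eq_one_iff_unique.mp hcard).1
        exact congrArg Subtype.val (hsub.elim ⟨x, hx⟩ ⟨0, zero_mem _⟩)
      have hQ0 : (Q : geomPoints W) = 0 := by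
        have := congrArg Subtype.val (hone _ hQmem)
        simpa using this
      have hQ0' : Q = 0 := Subtype.ext hQ0
      rw [hQ0', addOrderOf_zero] at hQ
      exact hpP.one_lt.ne' hQ.symm
    have hi1 : i = 1 := by omega
    rw [hcard, hi1, pow_one]
  · rw [hmem] at hP ⊢
    rw [AddSubgroup.torsionBy.coe_smul, ψ.map_smul, hP, smul_zero]

/-- **The induction.** For `E₁` globally minimal with good ordinary or multiplicative reduction at the
odd prime `p`, satisfying `GVPar` at `p`, with newform `f`, and any `ℚ`-isogeny `ψ : E₁ → E₂` to a
globally minimal `E₂`: `Ω(E₂) = u·Ω(E₁)` with `|u|_p = 1` — by strong induction on `#ker ψ`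
(§3 if `p ∤ #ker ψ`; `ψ = λ ∘ [p]` if `E₁[p] ⊆ ker ψ`; else `ψ = λ ∘ g` through the quotient by the
GV-type line `ker ψ ∩ E₁[p]`, §5, the hypotheses being carried to the quotient).
[cite: GreenbergVatsal2000, §3 Cor. (3.8) p. 40] -/
theorem exists_unit_of_isogeny_aux (hp2 : p ≠ 2) (n : ℕ) :
    ∀ (W₁ W₂ : WeierstrassCurve ℚ) (_ : W₁.IsElliptic) (_ : W₂.IsElliptic)
      (_ : W₁.IsGloballyMinimal) (_ : W₂.IsGloballyMinimal),
      ((W₁.HasGoodReductionAtPrime p ∧ ¬ (p : ℤ) ∣ W₁.frobeniusTrace p) ∨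
        W₁.HasMultiplicativeReductionAtPrime p) →
      GVPar W₁ p → IsNewformOf W₁ f →
      ∀ ψ : Isogeny W₁ W₂, ψ.degree = n →
        ∃ u : ℚ, ‖(u : ℚ_[p])‖ = 1 ∧ W₂.realPeriodRat = (u : ℝ) * W₁.realPeriodRat := by
  induction n using Nat.strong_induction_on with
  | _ n ih =>
  intro W₁ W₂ _ _ _ _ hred hpar hf ψ hn
  have hpP : p.Prime := hp.out
  by_cases hpn : p ∣ n
  swap
  · exact exists_unit_of_not_dvd_degree hf ψ (hn ▸ hpn)
  have hn0 : 0 < n := hn ▸ ψ.degree_pos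
  by_cases hall : ∀ P ∈ geomTorsion W₁ (p : ℤ), ψ P = 0
  · -- `E₁[p] ⊆ ker ψ`: `ψ = λ ∘ [p]`
    have hpK : ((p : ℤ) : ℚ) ≠ 0 := by exact_mod_cast hpP.ne_zero
    have hp0 : (p : ℤ) ≠ 0 := by exact_mod_cast hpP.ne_zero
    obtain ⟨lam, hlam⟩ := Isogeny.exists_eq_comp_zsmul_of_geomTorsion_le_ker hpK ψ hall
    have hfac : ∀ P, ψ P = lam (Isogeny.zsmul W₁ (p : ℤ) hp0 P) := fun P ↦ by
      rw [Isogeny.zsmul_apply]; exact hlam P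
    have hcount := natCard_ker_eq_mul_of_factor (Isogeny.zsmul W₁ (p : ℤ) hp0) ψ lam hfac
    have hkp : Nat.card (Isogeny.zsmul W₁ (p : ℤ) hp0).toAddMonoidHom.ker = p ^ 2 := by
      rw [Isogeny.ker_zsmul]; exact Rank1Residual.natCard_geomTorsion W₁ p
    rw [hkp] at hcount
    have hlt : lam.degree < n := by
      rw [← hn]
      change Nat.card lam.toAddMonoidHom.ker < Nat.card ψ.toAddMonoidHom.ker
      have h1 : 1 < p ^ 2 := Nat.one_lt_pow two_ne_zero hpP.one_lt
      have h2 : 0 < Nat.card lam.toAddMonoidHom.ker := lam.degree_pos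
      calc Nat.card lam.toAddMonoidHom.ker
          = Nat.card lam.toAddMonoidHom.ker * 1 := (mul_one _).symm
        _ < Nat.card lam.toAddMonoidHom.ker * p ^ 2 := Nat.mul_lt_mul_of_pos_left h1 h2
        _ = Nat.card ψ.toAddMonoidHom.ker := hcount.symm
    exact ih lam.degree hlt W₁ W₂ inferInstance inferInstance inferInstance inferInstance hred hpar
      hf lam rfl
  · -- the `p`-torsion part of the kernel is a GV-type rational line
    obtain ⟨P₁, hP₁'⟩ := not_forall.mp hall
    obtain ⟨hP₁, hψP₁⟩ := Classical.not_imp.mp hP₁'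
    set Φ₀ := ψ.toAddMonoidHom.ker.comap (geomTorsion W₁ (p : ℤ)).subtype with hΦ₀def
    have hΦ₀ : IsRationalLine W₁ p Φ₀ :=
      isRationalLine_ker_inf_torsion ψ (hn ▸ hpn) ⟨P₁, hP₁, hψP₁⟩
    have hL := exists_inertiaLine_of_goodOrd_or_mult W₁ p hp2 hred
    obtain ⟨Φ, hΦ, hΦtype⟩ := hpar
    have htype : (¬ LineUnramifiedAt W₁ p Φ₀ ∧ LineEven W₁ p Φ₀) ∨
        (LineUnramifiedAt W₁ p Φ₀ ∧ LineOdd W₁ p Φ₀) :=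
      gvType_of_isRationalLine_of_ordinaryLine hp2 (Rank1Residual.natCard_geomTorsion W₁ p) hL
        (exists_fixed_and_antifixed_of_isComplexConjugation W₁ hp2) hΦ hΦ₀ hΦtype
    -- the quotient by `Φ₀` onto a minimal model, and the one-step lemma
    obtain ⟨W₃, hW₃, hW₃', g, hgker, hgdeg⟩ := X2.IsogenyQuotientLine.exists_isogeny_ker_eq_line hΦ₀
    obtain ⟨u₁, hu₁, hΩ₁⟩ := exists_unit_of_ker_gvType hp2 hred hf hΦ₀ htype g hgker
    -- `ψ = λ ∘ g`
    have hle : ∀ P : geomPoints W₁, g P = 0 → ψ P = 0 := by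
      intro P hP
      have hmem : P ∈ g.toAddMonoidHom.ker := hP
      rw [hgker] at hmem
      obtain ⟨Q, hQ, rfl⟩ := hmem
      have hQ' : Q ∈ Φ₀ := hQ
      rw [hΦ₀def, AddSubgroup.mem_comap, AddMonoidHom.mem_ker] at hQ'
      exact hQ'
    obtain ⟨lam, hfac⟩ := exists_factor_of_ker_le g ψ hle
    have hcount := natCard_ker_eq_mul_of_factor g ψ lam hfac
    have hkg : Nat.card g.toAddMonoidHom.ker = p := hgdeg
    rw [hkg] at hcount
    have hlt : lam.degree < n := by
      rw [← hn]
      change Nat.card lam.toAddMonoidHom.ker < Nat.card ψ.toAddMonoidHom.ker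
      have h2 : 0 < Nat.card lam.toAddMonoidHom.ker := lam.degree_pos
      calc Nat.card lam.toAddMonoidHom.ker
          = Nat.card lam.toAddMonoidHom.ker * 1 := (mul_one _).symm
        _ < Nat.card lam.toAddMonoidHom.ker * p := Nat.mul_lt_mul_of_pos_left hpP.one_lt h2
        _ = Nat.card ψ.toAddMonoidHom.ker := hcount.symm
    -- the hypotheses for `E₃ = E₁/Φ₀`
    have hiso₃ : IsIsogenous W₁ W₃ := ⟨g⟩
    have hred₃ := goodOrd_or_mult_of_isIsogenous (p := p) hiso₃ hred
    have hf₃ : IsNewformOf W₃ f := hf.of_isIsogenous hiso₃.symm_of_charZero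
    have hgP₁ : g P₁ ≠ 0 := fun h ↦ hψP₁ (by rw [hfac, h, map_zero])
    have hpar₃ : GVPar W₃ p :=
      gvPar_of_isogeny_of_ordinaryLine hp2 hL g ⟨P₁, hP₁, hgP₁⟩ ⟨Φ, hΦ, hΦtype⟩
    obtain ⟨u₂, hu₂, hΩ₂⟩ := ih lam.degree hlt W₃ W₂ hW₃ inferInstance hW₃' inferInstance hred₃
      hpar₃ hf₃ lam rfl
    refine ⟨u₂ * u₁, ?_, ?_⟩
    · rw [Rat.cast_mul, norm_mul, hu₂, hu₁, one_mul]
    · rw [hΩ₂, hΩ₁, Rat.cast_mul, mul_assoc]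

/-- **Greenberg–Vatsal 2000, Cor. (3.8), period clause (relative form), PROVED.** For `ℚ`-isogenous
elliptic curves `E`, `E'` on globally minimal models, `p` an odd prime of good ordinary or
multiplicative reduction for `E`, `E` modular with newform `f`, and `E` satisfying the parity
hypothesis `GVPar` at `p` (some rational `p`-isogeny kernel unramified-odd or ramified-even):
`Ω(E') = u · Ω(E)` with `u ∈ ℚ`, `|u|_p = 1`. (The hypothesis `GVPar E'` of the registered fact is
not needed: the type is an isogeny-class invariant.) [cite: GreenbergVatsal2000, §3 Cor. (3.8) p. 40]
-/
theorem realPeriodRat_eq_unit_mul_of_isIsogenous_of_gvPar [W.IsElliptic] [W'.IsElliptic]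
    [W.IsGloballyMinimal] [W'.IsGloballyMinimal] {f : CuspForm (Gamma0 N) 2} (hp2 : p ≠ 2)
    (hf : IsNewformOf W f)
    (hred : (W.HasGoodReductionAtPrime p ∧ ¬ (p : ℤ) ∣ W.frobeniusTrace p) ∨
      W.HasMultiplicativeReductionAtPrime p)
    (hiso : IsIsogenous W W') (hpar : GVPar W p) :
    ∃ u : ℚ, ‖(u : ℚ_[p])‖ = 1 ∧ W'.realPeriodRat = (u : ℝ) * W.realPeriodRat := by
  obtain ⟨ψ⟩ := hiso
  exact exists_unit_of_isogeny_aux f hp2 ψ.degree W W' inferInstance inferInstance inferInstance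
    inferInstance hred hpar hf ψ rfl

end Induction

end Summit.BirchSwinnertonDyer.Rank1Residual.GVPeriod

/-! ## §7. The registered named fact A180, discharged -/

/-- **Discharge of the named fact
`GreenbergVatsal2000.cor38_realPeriodRat_eq_unit_mul_of_isIsogenous_of_gvPar`** (Greenberg–Vatsal,
Invent. Math. 142 (2000), §3 Cor. (3.8) p. 40, period clause, relative form for two members of one
`ℚ`-isogeny class; registry row A180 of the cell `b2b-bsdres`). The statement is the Literature
`def` BY NAME (nothing restated); the proof is
`GVPeriod.realPeriodRat_eq_unit_mul_of_isIsogenous_of_gvPar`. It lives under `Summits/` (and is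
declared with its absolute Literature name) only because its proof uses the cell's Summits-side
elementary theory (`X2.IsogenyPeriodRatio`, `Partition/EisensteinKernelInertiaLineMult`), which a
Literature module may not import; it depends on no problem statement, route or conjecture
(`#print axioms`: `propext`, `Classical.choice`, `Quot.sound`). Consumers `(hP : cor38_…)` of
`Partition/CornersMult*`, `Partition/CornersFiveLe*`, `X2/ClassClosureOfDatum` are fed this term.
[cite: GreenbergVatsal2000, §3 Cor. (3.8) (p. 40) with p. 32, p. 36 and the proof of Lemma (3.6) (p. 38)] -/
theorem Literature.NumberTheory.EllipticCurves.GreenbergVatsal2000.cor38_realPeriodRat_eq_unit_mul_of_isIsogenous_of_gvPar_holds :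
    cor38_realPeriodRat_eq_unit_mul_of_isIsogenous_of_gvPar := by
  intro W W' _ _ _ _ p _ N _ f hp2 hf hred hiso hpar _
  exact Summit.BirchSwinnertonDyer.Rank1Residual.GVPeriod.realPeriodRat_eq_unit_mul_of_isIsogenous_of_gvPar
    hp2 hf hred hiso hpar

end
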